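import Mathlib.GroupTheory.SpecificGroups.Dihedral
import Mathlib.Data.ZMod.Basic
import Mathlib.SetTheory.Cardinal.Finite
import Literature.Combinatorics.Additive.TripleProductProperty
import Literature.Computability.AlgebraicComplexity.CohnUmansTPP
import Literature.Computability.AlgebraicComplexity.CohnUmansDihedralSubgroupTPP
import HarnessLib

/-!
# Hedtke–Murthy's Table 2 (selected `2`-groups): `D₈ × D₈` and `C₂ × D₈ × D₈` realize `⟨8,4,4⟩` and `⟨16,4,4⟩`
# through subgroups (TPP subgroup ratio `β_g/|G| = 2`)

Topic `Literature/Computability/AlgebraicComplexity` (group-theoretic matrix multiplication; companion of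
`CohnUmansTPP.lean` (`RealizesTPP`), `CohnUmansDihedralSubgroupTPP.lean` (`SubgroupTPP`),
`TPPCapacitySL3F2.lean` (Lemma 7.1) and `TPPCapacitySL2Tables.lean` (Tables 3–4) of the same paper).

I. Hedtke, S. Murthy, *Search and test algorithms for triple product property triples*, Groups Complex.
Cryptol. 4 (2012) 111–133, doi:10.1515/gcc-2012-0006 = arXiv:1104.5097v2 (11 May 2011; "14 pages, 2 figures,
4 tables"). Read first-hand from the arXiv e-print source (`2011TPPAlgorithms.tex`, sha256 prefix `fa8eeeba4eaa9c6c`;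
the held text layer `paper:arxiv-1104.5097` omits the tables), §7.2 "Computational Results for some `2`-Groups"
(tex L726–L747):

> An interesting point is, that the only groups we found with the brute-force search for subgroups that achieve
> `β/D₃ > 0.8` are `2`-groups. The results for groups of order `64` and `128` are shown in table 2. (L729)

Table 2 (`tab:Two`, caption "Computational results for selected `2`-groups.", columns
`GAP Id | Group | D₃(G) | β_g(G) | β_g/D₃ | β_g/|G| | ⟨n,p,m⟩`), the two rows re-derived here, verbatim:
`[64,226] | D₈² | 144 | 128 | 0.888889 | 2 | 8,4,4` (L736) and `[128,2194] | C₂ × D₈² | 288 | 256 | 0.888889 | 2 |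
16,4,4` (L742). Here `β_g(G) := max {npm : G realizes ⟨n,p,m⟩ through subgroups}` is the TPP subgroup capacity
(Def. `def:TPPcap`, §1, L125–L128) and `D₈` is the dihedral group of order `8`.

## What is formalized (all proved; `0 defs / 0 facts`)
As for Tables 3–4, only the LOWER halves (`β_g ≥`, i.e. the existence of a TPP triple of SUBGROUPS of the printed
orders) are re-derived; the printed equalities are computational claims of the paper. The paper does not print the
triples; the ones below were found by a seconds-long search and are decided by the kernel (`decide +kernel` in
Mathlib's `DihedralGroup 4`, where `r i * r j = r (i+j)`, `r i * sr j = sr (j-i)`, `sr i * r j = sr (i+j)`,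
`sr i * sr j = r (j-i)`):

* `D₈ × D₈ = DihedralGroup 4 × DihedralGroup 4` (order `64`): `S = {(g, ḡ) : g ∈ D₈}` with `r i ↦ r (-i)`,
  `sr i ↦ sr (-i)` — the "inversion-twisted diagonal", a dihedral subgroup of order `8`, explicitly
  `{(r0,r0), (r1,r3), (r2,r2), (r3,r1), (sr0,sr0), (sr1,sr3), (sr2,sr2), (sr3,sr1)}`; `T = {1, (r0,sr1), (sr0,r0),
  (sr0,sr1)}` and `U = {1, (r2,sr0), (sr1,r0), (sr3,sr0)}` (Klein four-groups):
  `HedtkeMurthy2012_tableTwo_d8sq{_triple,_subgroups,}` — `⟨8,4,4⟩`, `128 = 2·64`.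
* `C₂ × D₈ × D₈ = Multiplicative (ZMod 2) × (DihedralGroup 4 × DihedralGroup 4)` (order `128`; the printed row's
  structure description `C₂ × D₈²`, GAP id `[128,2194]` as printed — the identification of the id is the paper's):
  `S' = C₂ × S` (order `16`), `T' = 1 × T`, `U' = 1 × U`: `HedtkeMurthy2012_tableTwo_c2d8sq{_triple,_subgroups,}` —
  `⟨16,4,4⟩`, `256 = 2·128`. (This is also the direct-product construction of Cohn–Umans 2003, Lemma 2.2, applied
  to `⟨2,1,1⟩` in `C₂` and `⟨8,4,4⟩` in `D₈²`; the file simply decides the product triple.)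

Relation to the tree: `Summits/MatrixMultiplication/OmegaCensus/D8ProdD8Capacity.lean` has a SUBSET triple of type
`(8,4,4)` in `D₈ × D₈` (`d8_prod_d8_tpp_844`, lifted from `2^{1+4}_+`); the present triple consists of SUBGROUPS,
which is what the printed `β_g` column asserts. The other rows of Table 2 (`[128,29]`, `[128,1135]`, `[128,1142]`,
`[128,1165]`, `[128,2213]`, iterated semidirect products) are not treated.

The step "three subgroups with `T ∩ U = 1` and `S ∩ TU = 1` form a TPP triple" is Hedtke–Murthy's Thm. 3.1 for
subgroups; it is the private glue lemma `subgroupTriple_of_carrierFacts` (same statement and proof as in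
`TPPCapacitySL2Tables.lean`, kept private in both files so that neither depends on the other's build).

## References
* I. Hedtke, S. Murthy, arXiv:1104.5097v2 = Groups Complex. Cryptol. 4 (2012): §7.2, Table 2 (`tab:Two`) rows
  `[64,226]` (L736) and `[128,2194]` (L742); Thm. 3.1; Def. of `β_g` (§1, `def:TPPcap`). [HedtkeMurthy2012]
* H. Cohn, C. Umans, FOCS 2003, arXiv:math/0307321: Def. 2.1 (triple product property; remark on subgroups),
  Lemma 2.2 (direct products). [CohnUmans2003]
-/

namespace Literature.Computability.AlgebraicComplexity

open Literature.Combinatorics.Additive Literature.Computability.AlgebraicComplexity.DihedralSubgroups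

/-! ## Glue: carriers of subgroups with `b c ∈ S ⇒ b = c = 1` give a TPP triple of subgroups -/

section General

variable {G : Type*} [Group G]

/-- In a finite set in which every element has a right inverse inside the set, inverses stay inside. [folklore] -/
private theorem inv_mem_of_mul_eq_one {X : Finset G} (hX : ∀ x ∈ X, ∃ y ∈ X, x * y = 1) {x : G} (hx : x ∈ X) :
    x⁻¹ ∈ X := by
  obtain ⟨y, hy, hxy⟩ := hX x hx
  rw [inv_eq_of_mul_eq_one_right hxy]
  exact hy

/-- **Glue (Hedtke–Murthy 2012, Thm. 3.1 for subgroups: `T ∩ U = 1 ∧ S ∩ TU = 1` ⇒ `(S,T,U)` is a basic TPP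
triple).** If the finite sets `S, T, U ⊆ G` are carriers of subgroups (contain `1`, closed under products,
inverses inside) of sizes `nS, nT, nU`, and `b c ∈ S` with `b ∈ T`, `c ∈ U` forces `b = c = 1`, then `(S, T, U)`
has the triple product property (right-quotient form of the tree), and there are subgroups `H₁, H₂, H₃ ≤ G` with
these carriers, of orders `nS, nT, nU`, satisfying `SubgroupTPP H₁ H₂ H₃`. [cite: HedtkeMurthy2012, Thm. 3.1] -/
private theorem subgroupTriple_of_carrierFacts {S T U : Finset G} {nS nT nU : ℕ}
    (hS : S.card = nS ∧ (1 : G) ∈ S ∧ (∀ x ∈ S, ∀ y ∈ S, x * y ∈ S) ∧ (∀ x ∈ S, ∃ y ∈ S, x * y = 1))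
    (hT : T.card = nT ∧ (1 : G) ∈ T ∧ (∀ x ∈ T, ∀ y ∈ T, x * y ∈ T) ∧ (∀ x ∈ T, ∃ y ∈ T, x * y = 1))
    (hU : U.card = nU ∧ (1 : G) ∈ U ∧ (∀ x ∈ U, ∀ y ∈ U, x * y ∈ U) ∧ (∀ x ∈ U, ∃ y ∈ U, x * y = 1))
    (hkey : ∀ b ∈ T, ∀ c ∈ U, b * c ∈ S → b = 1 ∧ c = 1) :
    (TripleProductProperty S T U ∧ S.card = nS ∧ T.card = nT ∧ U.card = nU) ∧
      ∃ H₁ H₂ H₃ : Subgroup G, (H₁ : Set G) = S ∧ (H₂ : Set G) = T ∧ (H₃ : Set G) = U ∧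
        Nat.card H₁ = nS ∧ Nat.card H₂ = nT ∧ Nat.card H₃ = nU ∧ SubgroupTPP H₁ H₂ H₃ := by
  obtain ⟨hcS, h1S, hmS, hiS⟩ := hS
  obtain ⟨hcT, h1T, hmT, hiT⟩ := hT
  obtain ⟨hcU, h1U, hmU, hiU⟩ := hU
  have hcond : ∀ a ∈ S, ∀ b ∈ T, ∀ c ∈ U, a * b * c = 1 → a = 1 ∧ b = 1 ∧ c = 1 := by
    intro a ha b hb c hc habc
    have hinv : a⁻¹ = b * c := inv_eq_of_mul_eq_one_right (by rw [← mul_assoc]; exact habc)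
    obtain ⟨hb1, hc1⟩ := hkey b hb c hc (hinv ▸ inv_mem_of_mul_eq_one hiS ha)
    refine ⟨?_, hb1, hc1⟩
    rwa [hb1, hc1, mul_one, mul_one] at habc
  refine ⟨⟨?_, hcS, hcT, hcU⟩, ?_⟩
  · intro s hs s' hs' t ht t' ht' u hu u' hu' he
    obtain ⟨h1, h2, h3⟩ := hcond _ (hmS _ hs _ (inv_mem_of_mul_eq_one hiS hs')) _
      (hmT _ ht _ (inv_mem_of_mul_eq_one hiT ht')) _ (hmU _ hu _ (inv_mem_of_mul_eq_one hiU hu')) he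
    exact ⟨mul_inv_eq_one.1 h1, mul_inv_eq_one.1 h2, mul_inv_eq_one.1 h3⟩
  · have card_eq : ∀ (H : Subgroup G) (X : Finset G), (H : Set G) = X → Nat.card H = X.card := by
      intro H X e
      rw [← SetLike.coe_sort_coe, e, Finset.coe_sort_coe, Nat.card_eq_fintype_card, Fintype.card_coe]
    refine ⟨{ carrier := S, mul_mem' := fun hx hy => hmS _ hx _ hy, one_mem' := h1S,
              inv_mem' := fun hx => inv_mem_of_mul_eq_one hiS hx },
            { carrier := T, mul_mem' := fun hx hy => hmT _ hx _ hy, one_mem' := h1T,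
              inv_mem' := fun hx => inv_mem_of_mul_eq_one hiT hx },
            { carrier := U, mul_mem' := fun hx hy => hmU _ hx _ hy, one_mem' := h1U,
              inv_mem' := fun hx => inv_mem_of_mul_eq_one hiU hx },
            rfl, rfl, rfl, (card_eq _ _ rfl).trans hcS, (card_eq _ _ rfl).trans hcT, (card_eq _ _ rfl).trans hcU, ?_⟩
    intro a ha b hb c hc habc
    exact hcond a ha b hb c hc habc

end General

/-! ## `D₈ × D₈`: `⟨8, 4, 4⟩` (Table 2 row `[64,226]`) -/

section D8Sq

open DihedralGroup

/-- Carrier facts for `S` = the inversion-twisted diagonal copy of `D₈` in `D₈ × D₈` (kernel computation): size `8`,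
contains `1`, closed under products, inverses inside. [cite: HedtkeMurthy2012, Table 2 (tab:Two) row [64,226]] -/
private theorem factsS_d8sq :
    let S : Finset (DihedralGroup 4 × DihedralGroup 4) :=
      {(r 0, r 0), (r 1, r 3), (r 2, r 2), (r 3, r 1), (sr 0, sr 0), (sr 1, sr 3), (sr 2, sr 2), (sr 3, sr 1)}
    S.card = 8 ∧ (1 : DihedralGroup 4 × DihedralGroup 4) ∈ S ∧ (∀ x ∈ S, ∀ y ∈ S, x * y ∈ S) ∧
      (∀ x ∈ S, ∃ y ∈ S, x * y = 1) := by
  decide +kernel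

/-- Carrier facts for `T = {1, (r0,sr1), (sr0,r0), (sr0,sr1)}` (kernel computation): size `4`, contains `1`, closed
under products, inverses inside. [cite: HedtkeMurthy2012, Table 2 (tab:Two) row [64,226]] -/
private theorem factsT_d8sq :
    let T : Finset (DihedralGroup 4 × DihedralGroup 4) := {(r 0, r 0), (r 0, sr 1), (sr 0, r 0), (sr 0, sr 1)}
    T.card = 4 ∧ (1 : DihedralGroup 4 × DihedralGroup 4) ∈ T ∧ (∀ x ∈ T, ∀ y ∈ T, x * y ∈ T) ∧
      (∀ x ∈ T, ∃ y ∈ T, x * y = 1) := by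
  decide +kernel

/-- Carrier facts for `U = {1, (r2,sr0), (sr1,r0), (sr3,sr0)}` (kernel computation): size `4`, contains `1`, closed
under products, inverses inside. [cite: HedtkeMurthy2012, Table 2 (tab:Two) row [64,226]] -/
private theorem factsU_d8sq :
    let U : Finset (DihedralGroup 4 × DihedralGroup 4) := {(r 0, r 0), (r 2, sr 0), (sr 1, r 0), (sr 3, sr 0)}
    U.card = 4 ∧ (1 : DihedralGroup 4 × DihedralGroup 4) ∈ U ∧ (∀ x ∈ U, ∀ y ∈ U, x * y ∈ U) ∧
      (∀ x ∈ U, ∃ y ∈ U, x * y = 1) := by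
  decide +kernel

/-- The key clause (kernel computation over `16` products): `g h ∈ S` with `g ∈ T`, `h ∈ U` only for `g = h = 1`
("`T ∩ U = 1` and `S ∩ TU = 1`"). [cite: HedtkeMurthy2012, Table 2 (tab:Two) row [64,226]] -/
private theorem key_d8sq :
    let S : Finset (DihedralGroup 4 × DihedralGroup 4) :=
      {(r 0, r 0), (r 1, r 3), (r 2, r 2), (r 3, r 1), (sr 0, sr 0), (sr 1, sr 3), (sr 2, sr 2), (sr 3, sr 1)}
    let T : Finset (DihedralGroup 4 × DihedralGroup 4) := {(r 0, r 0), (r 0, sr 1), (sr 0, r 0), (sr 0, sr 1)}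
    let U : Finset (DihedralGroup 4 × DihedralGroup 4) := {(r 0, r 0), (r 2, sr 0), (sr 1, r 0), (sr 3, sr 0)}
    ∀ g ∈ T, ∀ h ∈ U, g * h ∈ S → g = 1 ∧ h = 1 := by
  decide +kernel

/-- **Hedtke–Murthy 2012, Table 2 row `[64,226]` `D₈²` (`⟨8,4,4⟩`), the triple**: in `D₈ × D₈` the inversion-twisted
diagonal `S` (order `8`) and the Klein four-groups `T = {1, (r0,sr1), (sr0,r0), (sr0,sr1)}`,
`U = {1, (r2,sr0), (sr1,r0), (sr3,sr0)}` satisfy the triple product property.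
[cite: HedtkeMurthy2012, Table 2 (tab:Two) row [64,226]] -/
theorem HedtkeMurthy2012_tableTwo_d8sq_triple :
    let S : Finset (DihedralGroup 4 × DihedralGroup 4) :=
      {(r 0, r 0), (r 1, r 3), (r 2, r 2), (r 3, r 1), (sr 0, sr 0), (sr 1, sr 3), (sr 2, sr 2), (sr 3, sr 1)}
    let T : Finset (DihedralGroup 4 × DihedralGroup 4) := {(r 0, r 0), (r 0, sr 1), (sr 0, r 0), (sr 0, sr 1)}
    let U : Finset (DihedralGroup 4 × DihedralGroup 4) := {(r 0, r 0), (r 2, sr 0), (sr 1, r 0), (sr 3, sr 0)}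
    TripleProductProperty S T U ∧ S.card = 8 ∧ T.card = 4 ∧ U.card = 4 := by
  obtain ⟨hS, hT, hU, hkey⟩ := (⟨factsS_d8sq, factsT_d8sq, factsU_d8sq, key_d8sq⟩ : _ ∧ _ ∧ _ ∧ _)
  exact (subgroupTriple_of_carrierFacts hS hT hU hkey).1

/-- **Hedtke–Murthy 2012, Table 2 row `[64,226]` ("through subgroups")**: `D₈ × D₈` has subgroups of orders
`8, 4, 4` satisfying the subgroup triple product property, i.e. `β_g(D₈²) ≥ 128`.
[cite: HedtkeMurthy2012, Table 2 (tab:Two) row [64,226]] -/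
theorem HedtkeMurthy2012_tableTwo_d8sq_subgroups :
    ∃ H₁ H₂ H₃ : Subgroup (DihedralGroup 4 × DihedralGroup 4), Nat.card H₁ = 8 ∧ Nat.card H₂ = 4 ∧ Nat.card H₃ = 4 ∧
      SubgroupTPP H₁ H₂ H₃ := by
  obtain ⟨-, H₁, H₂, H₃, -, -, -, h1, h2, h3, h⟩ :=
    subgroupTriple_of_carrierFacts factsS_d8sq factsT_d8sq factsU_d8sq key_d8sq
  exact ⟨H₁, H₂, H₃, h1, h2, h3, h⟩

/-- **Hedtke–Murthy 2012, Table 2 row `[64,226]`**: `D₈ × D₈` realizes `⟨8,4,4⟩`; `|D₈ × D₈| = 64` and `128 = 2·64`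
(printed ratio `β_g/|G| = 2`). [cite: HedtkeMurthy2012, Table 2 (tab:Two) row [64,226]] -/
theorem HedtkeMurthy2012_tableTwo_d8sq :
    RealizesTPP (DihedralGroup 4 × DihedralGroup 4) 8 4 4 ∧ Nat.card (DihedralGroup 4 × DihedralGroup 4) = 64 ∧
      8 * 4 * 4 = 2 * Nat.card (DihedralGroup 4 × DihedralGroup 4) := by
  have hc : Nat.card (DihedralGroup 4 × DihedralGroup 4) = 64 := by
    rw [Nat.card_prod, DihedralGroup.nat_card]
  obtain ⟨htpp, h1, h2, h3⟩ := HedtkeMurthy2012_tableTwo_d8sq_triple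
  exact ⟨⟨_, _, _, h1, h2, h3, htpp⟩, hc, by rw [hc]⟩

end D8Sq

/-! ## `C₂ × D₈ × D₈`: `⟨16, 4, 4⟩` (Table 2 row `[128,2194]`) -/

section C2D8Sq

open DihedralGroup

/-! The carrier facts for `S' = C₂ × S`, `T' = 1 × T`, `U' = 1 × U` are stated one clause at a time (for this
product type the instance search for a conjunction of the four clauses does not go through, while each clause alone is
decided by the kernel). -/

/-- `|S'| = 16` for `S' = C₂ × S` (kernel computation). [cite: HedtkeMurthy2012, Table 2 (tab:Two) row [128,2194]] -/
private theorem cardS_c2d8sq :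
    let S' : Finset (Multiplicative (ZMod 2) × (DihedralGroup 4 × DihedralGroup 4)) :=
      {(1, (r 0, r 0)), (1, (r 1, r 3)), (1, (r 2, r 2)), (1, (r 3, r 1)), (1, (sr 0, sr 0)), (1, (sr 1, sr 3)),
       (1, (sr 2, sr 2)), (1, (sr 3, sr 1)), (Multiplicative.ofAdd 1, (r 0, r 0)), (Multiplicative.ofAdd 1,
       (r 1, r 3)), (Multiplicative.ofAdd 1, (r 2, r 2)), (Multiplicative.ofAdd 1, (r 3, r 1)),
       (Multiplicative.ofAdd 1, (sr 0, sr 0)), (Multiplicative.ofAdd 1, (sr 1, sr 3)),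
       (Multiplicative.ofAdd 1, (sr 2, sr 2)), (Multiplicative.ofAdd 1, (sr 3, sr 1))}
    S'.card = 16 := by
  decide +kernel

/-- `1 ∈ S'` (kernel computation). [cite: HedtkeMurthy2012, Table 2 (tab:Two) row [128,2194]] -/
private theorem oneS_c2d8sq :
    let S' : Finset (Multiplicative (ZMod 2) × (DihedralGroup 4 × DihedralGroup 4)) :=
      {(1, (r 0, r 0)), (1, (r 1, r 3)), (1, (r 2, r 2)), (1, (r 3, r 1)), (1, (sr 0, sr 0)), (1, (sr 1, sr 3)),
       (1, (sr 2, sr 2)), (1, (sr 3, sr 1)), (Multiplicative.ofAdd 1, (r 0, r 0)), (Multiplicative.ofAdd 1,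
       (r 1, r 3)), (Multiplicative.ofAdd 1, (r 2, r 2)), (Multiplicative.ofAdd 1, (r 3, r 1)),
       (Multiplicative.ofAdd 1, (sr 0, sr 0)), (Multiplicative.ofAdd 1, (sr 1, sr 3)),
       (Multiplicative.ofAdd 1, (sr 2, sr 2)), (Multiplicative.ofAdd 1, (sr 3, sr 1))}
    (1 : Multiplicative (ZMod 2) × (DihedralGroup 4 × DihedralGroup 4)) ∈ S' := by
  decide +kernel

/-- `S'` is closed under products (kernel computation). [cite: HedtkeMurthy2012, Table 2 (tab:Two) row [128,2194]] -/
private theorem mulS_c2d8sq :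
    let S' : Finset (Multiplicative (ZMod 2) × (DihedralGroup 4 × DihedralGroup 4)) :=
      {(1, (r 0, r 0)), (1, (r 1, r 3)), (1, (r 2, r 2)), (1, (r 3, r 1)), (1, (sr 0, sr 0)), (1, (sr 1, sr 3)),
       (1, (sr 2, sr 2)), (1, (sr 3, sr 1)), (Multiplicative.ofAdd 1, (r 0, r 0)), (Multiplicative.ofAdd 1,
       (r 1, r 3)), (Multiplicative.ofAdd 1, (r 2, r 2)), (Multiplicative.ofAdd 1, (r 3, r 1)),
       (Multiplicative.ofAdd 1, (sr 0, sr 0)), (Multiplicative.ofAdd 1, (sr 1, sr 3)),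
       (Multiplicative.ofAdd 1, (sr 2, sr 2)), (Multiplicative.ofAdd 1, (sr 3, sr 1))}
    ∀ x ∈ S', ∀ y ∈ S', x * y ∈ S' := by
  decide +kernel

/-- Every element of `S'` has an inverse in `S'` (kernel computation). [cite: HedtkeMurthy2012, Table 2 (tab:Two) row [128,2194]] -/
private theorem invS_c2d8sq :
    let S' : Finset (Multiplicative (ZMod 2) × (DihedralGroup 4 × DihedralGroup 4)) :=
      {(1, (r 0, r 0)), (1, (r 1, r 3)), (1, (r 2, r 2)), (1, (r 3, r 1)), (1, (sr 0, sr 0)), (1, (sr 1, sr 3)),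
       (1, (sr 2, sr 2)), (1, (sr 3, sr 1)), (Multiplicative.ofAdd 1, (r 0, r 0)), (Multiplicative.ofAdd 1,
       (r 1, r 3)), (Multiplicative.ofAdd 1, (r 2, r 2)), (Multiplicative.ofAdd 1, (r 3, r 1)),
       (Multiplicative.ofAdd 1, (sr 0, sr 0)), (Multiplicative.ofAdd 1, (sr 1, sr 3)),
       (Multiplicative.ofAdd 1, (sr 2, sr 2)), (Multiplicative.ofAdd 1, (sr 3, sr 1))}
    ∀ x ∈ S', ∃ y ∈ S', x * y = 1 := by
  decide +kernel

/-- `|T'| = 4` for `T' = 1 × T` (kernel computation). [cite: HedtkeMurthy2012, Table 2 (tab:Two) row [128,2194]] -/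
private theorem cardT_c2d8sq :
    let T' : Finset (Multiplicative (ZMod 2) × (DihedralGroup 4 × DihedralGroup 4)) :=
      {(1, (r 0, r 0)), (1, (r 0, sr 1)), (1, (sr 0, r 0)), (1, (sr 0, sr 1))}
    T'.card = 4 := by
  decide +kernel

/-- `1 ∈ T'` (kernel computation). [cite: HedtkeMurthy2012, Table 2 (tab:Two) row [128,2194]] -/
private theorem oneT_c2d8sq :
    let T' : Finset (Multiplicative (ZMod 2) × (DihedralGroup 4 × DihedralGroup 4)) :=
      {(1, (r 0, r 0)), (1, (r 0, sr 1)), (1, (sr 0, r 0)), (1, (sr 0, sr 1))}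
    (1 : Multiplicative (ZMod 2) × (DihedralGroup 4 × DihedralGroup 4)) ∈ T' := by
  decide +kernel

/-- `T'` is closed under products (kernel computation). [cite: HedtkeMurthy2012, Table 2 (tab:Two) row [128,2194]] -/
private theorem mulT_c2d8sq :
    let T' : Finset (Multiplicative (ZMod 2) × (DihedralGroup 4 × DihedralGroup 4)) :=
      {(1, (r 0, r 0)), (1, (r 0, sr 1)), (1, (sr 0, r 0)), (1, (sr 0, sr 1))}
    ∀ x ∈ T', ∀ y ∈ T', x * y ∈ T' := by
  decide +kernel

/-- Every element of `T'` has an inverse in `T'` (kernel computation). [cite: HedtkeMurthy2012, Table 2 (tab:Two) row [128,2194]] -/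
private theorem invT_c2d8sq :
    let T' : Finset (Multiplicative (ZMod 2) × (DihedralGroup 4 × DihedralGroup 4)) :=
      {(1, (r 0, r 0)), (1, (r 0, sr 1)), (1, (sr 0, r 0)), (1, (sr 0, sr 1))}
    ∀ x ∈ T', ∃ y ∈ T', x * y = 1 := by
  decide +kernel

/-- `|U'| = 4` for `U' = 1 × U` (kernel computation). [cite: HedtkeMurthy2012, Table 2 (tab:Two) row [128,2194]] -/
private theorem cardU_c2d8sq :
    let U' : Finset (Multiplicative (ZMod 2) × (DihedralGroup 4 × DihedralGroup 4)) :=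
      {(1, (r 0, r 0)), (1, (r 2, sr 0)), (1, (sr 1, r 0)), (1, (sr 3, sr 0))}
    U'.card = 4 := by
  decide +kernel

/-- `1 ∈ U'` (kernel computation). [cite: HedtkeMurthy2012, Table 2 (tab:Two) row [128,2194]] -/
private theorem oneU_c2d8sq :
    let U' : Finset (Multiplicative (ZMod 2) × (DihedralGroup 4 × DihedralGroup 4)) :=
      {(1, (r 0, r 0)), (1, (r 2, sr 0)), (1, (sr 1, r 0)), (1, (sr 3, sr 0))}
    (1 : Multiplicative (ZMod 2) × (DihedralGroup 4 × DihedralGroup 4)) ∈ U' := by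
  decide +kernel

/-- `U'` is closed under products (kernel computation). [cite: HedtkeMurthy2012, Table 2 (tab:Two) row [128,2194]] -/
private theorem mulU_c2d8sq :
    let U' : Finset (Multiplicative (ZMod 2) × (DihedralGroup 4 × DihedralGroup 4)) :=
      {(1, (r 0, r 0)), (1, (r 2, sr 0)), (1, (sr 1, r 0)), (1, (sr 3, sr 0))}
    ∀ x ∈ U', ∀ y ∈ U', x * y ∈ U' := by
  decide +kernel

/-- Every element of `U'` has an inverse in `U'` (kernel computation). [cite: HedtkeMurthy2012, Table 2 (tab:Two) row [128,2194]] -/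
private theorem invU_c2d8sq :
    let U' : Finset (Multiplicative (ZMod 2) × (DihedralGroup 4 × DihedralGroup 4)) :=
      {(1, (r 0, r 0)), (1, (r 2, sr 0)), (1, (sr 1, r 0)), (1, (sr 3, sr 0))}
    ∀ x ∈ U', ∃ y ∈ U', x * y = 1 := by
  decide +kernel

/-- The key clause for `(S', T', U')` (kernel computation over `16` products). [cite: HedtkeMurthy2012, Table 2
(tab:Two) row [128,2194]] -/
private theorem key_c2d8sq :
    let S' : Finset (Multiplicative (ZMod 2) × (DihedralGroup 4 × DihedralGroup 4)) :=
      {(1, (r 0, r 0)), (1, (r 1, r 3)), (1, (r 2, r 2)), (1, (r 3, r 1)), (1, (sr 0, sr 0)), (1, (sr 1, sr 3)),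
       (1, (sr 2, sr 2)), (1, (sr 3, sr 1)), (Multiplicative.ofAdd 1, (r 0, r 0)), (Multiplicative.ofAdd 1,
       (r 1, r 3)), (Multiplicative.ofAdd 1, (r 2, r 2)), (Multiplicative.ofAdd 1, (r 3, r 1)),
       (Multiplicative.ofAdd 1, (sr 0, sr 0)), (Multiplicative.ofAdd 1, (sr 1, sr 3)),
       (Multiplicative.ofAdd 1, (sr 2, sr 2)), (Multiplicative.ofAdd 1, (sr 3, sr 1))}
    let T' : Finset (Multiplicative (ZMod 2) × (DihedralGroup 4 × DihedralGroup 4)) :=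
      {(1, (r 0, r 0)), (1, (r 0, sr 1)), (1, (sr 0, r 0)), (1, (sr 0, sr 1))}
    let U' : Finset (Multiplicative (ZMod 2) × (DihedralGroup 4 × DihedralGroup 4)) :=
      {(1, (r 0, r 0)), (1, (r 2, sr 0)), (1, (sr 1, r 0)), (1, (sr 3, sr 0))}
    ∀ g ∈ T', ∀ h ∈ U', g * h ∈ S' → g = 1 ∧ h = 1 := by
  decide +kernel

/-- **Hedtke–Murthy 2012, Table 2 row `[128,2194]` `C₂ × D₈²` (`⟨16,4,4⟩`), the triple**: in `C₂ × (D₈ × D₈)` the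
sets `S' = C₂ × S` (order `16`), `T' = 1 × T`, `U' = 1 × U` (order `4`), with `S, T, U` the `D₈²`-triple above
(written out as explicit finite sets; `Multiplicative.ofAdd 1` is the generator of `C₂`), satisfy the triple product
property. [cite: HedtkeMurthy2012, Table 2 (tab:Two) row [128,2194]] -/
theorem HedtkeMurthy2012_tableTwo_c2d8sq_triple :
    let S' : Finset (Multiplicative (ZMod 2) × (DihedralGroup 4 × DihedralGroup 4)) :=
      {(1, (r 0, r 0)), (1, (r 1, r 3)), (1, (r 2, r 2)), (1, (r 3, r 1)), (1, (sr 0, sr 0)), (1, (sr 1, sr 3)),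
       (1, (sr 2, sr 2)), (1, (sr 3, sr 1)), (Multiplicative.ofAdd 1, (r 0, r 0)), (Multiplicative.ofAdd 1,
       (r 1, r 3)), (Multiplicative.ofAdd 1, (r 2, r 2)), (Multiplicative.ofAdd 1, (r 3, r 1)),
       (Multiplicative.ofAdd 1, (sr 0, sr 0)), (Multiplicative.ofAdd 1, (sr 1, sr 3)),
       (Multiplicative.ofAdd 1, (sr 2, sr 2)), (Multiplicative.ofAdd 1, (sr 3, sr 1))}
    let T' : Finset (Multiplicative (ZMod 2) × (DihedralGroup 4 × DihedralGroup 4)) :=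
      {(1, (r 0, r 0)), (1, (r 0, sr 1)), (1, (sr 0, r 0)), (1, (sr 0, sr 1))}
    let U' : Finset (Multiplicative (ZMod 2) × (DihedralGroup 4 × DihedralGroup 4)) :=
      {(1, (r 0, r 0)), (1, (r 2, sr 0)), (1, (sr 1, r 0)), (1, (sr 3, sr 0))}
    TripleProductProperty S' T' U' ∧ S'.card = 16 ∧ T'.card = 4 ∧ U'.card = 4 := by
  exact (subgroupTriple_of_carrierFacts ⟨cardS_c2d8sq, oneS_c2d8sq, mulS_c2d8sq, invS_c2d8sq⟩
    ⟨cardT_c2d8sq, oneT_c2d8sq, mulT_c2d8sq, invT_c2d8sq⟩ ⟨cardU_c2d8sq, oneU_c2d8sq, mulU_c2d8sq, invU_c2d8sq⟩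
    key_c2d8sq).1

/-- **Hedtke–Murthy 2012, Table 2 row `[128,2194]` ("through subgroups")**: `C₂ × D₈ × D₈` has subgroups of orders
`16, 4, 4` satisfying the subgroup triple product property, i.e. `β_g(C₂ × D₈²) ≥ 256`.
[cite: HedtkeMurthy2012, Table 2 (tab:Two) row [128,2194]] -/
theorem HedtkeMurthy2012_tableTwo_c2d8sq_subgroups :
    ∃ H₁ H₂ H₃ : Subgroup (Multiplicative (ZMod 2) × (DihedralGroup 4 × DihedralGroup 4)),
      Nat.card H₁ = 16 ∧ Nat.card H₂ = 4 ∧ Nat.card H₃ = 4 ∧ SubgroupTPP H₁ H₂ H₃ := by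
  obtain ⟨-, H₁, H₂, H₃, -, -, -, h1, h2, h3, h⟩ :=
    subgroupTriple_of_carrierFacts ⟨cardS_c2d8sq, oneS_c2d8sq, mulS_c2d8sq, invS_c2d8sq⟩
      ⟨cardT_c2d8sq, oneT_c2d8sq, mulT_c2d8sq, invT_c2d8sq⟩ ⟨cardU_c2d8sq, oneU_c2d8sq, mulU_c2d8sq, invU_c2d8sq⟩
      key_c2d8sq
  exact ⟨H₁, H₂, H₃, h1, h2, h3, h⟩

/-- **Hedtke–Murthy 2012, Table 2 row `[128,2194]`**: `C₂ × D₈ × D₈` realizes `⟨16,4,4⟩`; `|C₂ × D₈ × D₈| = 128`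
and `256 = 2·128` (printed ratio `β_g/|G| = 2`). [cite: HedtkeMurthy2012, Table 2 (tab:Two) row [128,2194]] -/
theorem HedtkeMurthy2012_tableTwo_c2d8sq :
    RealizesTPP (Multiplicative (ZMod 2) × (DihedralGroup 4 × DihedralGroup 4)) 16 4 4 ∧
      Nat.card (Multiplicative (ZMod 2) × (DihedralGroup 4 × DihedralGroup 4)) = 128 ∧
      16 * 4 * 4 = 2 * Nat.card (Multiplicative (ZMod 2) × (DihedralGroup 4 × DihedralGroup 4)) := by
  have hc : Nat.card (Multiplicative (ZMod 2) × (DihedralGroup 4 × DihedralGroup 4)) = 128 := by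
    rw [Nat.card_prod, Nat.card_prod, DihedralGroup.nat_card, Nat.card_eq_fintype_card, Fintype.card_multiplicative,
      ZMod.card]
  obtain ⟨htpp, h1, h2, h3⟩ := HedtkeMurthy2012_tableTwo_c2d8sq_triple
  exact ⟨⟨_, _, _, h1, h2, h3, htpp⟩, hc, by rw [hc]⟩

end C2D8Sq

end Literature.Computability.AlgebraicComplexity
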